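/-
  Summits/AtomisticToContinuum/Crystallization/Theorems/OverbindingBudgetAffineFarLatticeFill.lean

  residual stmt-AtomisticToContinuum-31280 · slot Z `FarAggregatePricing 12 (1/25) (1/2000) (1/(2·10⁷))` · leaf LAB₁′
  `ShelteredShellLabelling' (1/25) (1/2000)` (leaf list v14′, critic rows 890/899/908): E4 part 2 — LATTICE FILLING: the converse inclusion
  of BBI (every stacking point deep inside the identified ball IS a point of `Λ`), by a MINIMAL COUNTEREXAMPLE over the stacking
  (lens-4) and contact-shell counting.  decomp-a2c lens-4 «minimal counterexample / extremal reduction», generation 58.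
  Imports C4 `…FarCoreWindow` (recentring `mem_shift_iff`, window finiteness, inward directions) and BBI♯ `…FarBallBarlowSharp`
  (kissing patterns are contact shells).  0 sorry · 0 axiom · no instance · no notation · no option.
-/
import Summits.AtomisticToContinuum.Crystallization.Theorems.OverbindingBudgetAffineFarCoreWindow
import Summits.AtomisticToContinuum.Crystallization.Theorems.OverbindingBudgetAffineFarBallBarlowSharp

/-! # E4 part 2 — lattice filling (PROVED)

BBI½/BBI♯ deliver an INCLUSION: the points of `Λ` of norm `≤ r` lie in the based copy `g(𝓛(s) − p₀)`.  The labelling LAB₁′ also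
needs the CONVERSE on a slightly smaller ball — every stacking point is hit (surjectivity of the labelling onto the stacking ball, and
CORE's matching `hpt`).  `barlow_fill` (PROVED): if `0 ∈ Λ`, every point of `Λ` of norm `≤ ρ` carries an exact isometric fcc/hcp
two-shell pattern inside `Λ`, and `Λ ∩ B̄(0, r) ⊆ g(𝓛(s) − p₀)` with `r ≤ ρ + 1`, then `g(p − p₀) ∈ Λ` for EVERY `p ∈ 𝓛(s)` with
`‖p − p₀‖ ≤ r − 1`.
PROOF (lens-4).  Recentre (`𝓛(s) − p₀ = 𝓛(s(· + k₀))`, C4).  A counterexample `u` of minimal norm is `≠ 0` (`g 0 = 0 ∈ Λ`); its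
INWARD CONTACT NEIGHBOUR `u₁` (`0` if `‖u‖ = 1`, else `u + e` from C1's covering-constant lemma at `B = id`) is good by minimality, so
`x = g u₁ ∈ Λ` carries a pattern `x + A(P) ⊆ Λ`; its twelve unit vectors land (inclusion, norm `≤ r`) on twelve contact neighbours of
`u₁`; the contact shell of `u₁` has exactly twelve points (`ncard_barlowShell`), so the injective map `v ↦ g⁻¹(A v)` is ONTO it and
hits `u − u₁`: `g u = x + A v ∈ Λ`, contradiction.
HIDDEN-GAUGE / DEGENERATE AUDIT: no exhaustiveness hypothesis is used (only pattern membership, inclusion, `0 ∈ Λ`); the radius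
bookkeeping is `‖u₁‖ < ‖u‖ ≤ r − 1 ≤ ρ` (pattern available) and `‖x + A v‖ ≤ ‖u₁‖ + 1 ≤ r` (inclusion available).
-/

namespace Summit.AtomisticToContinuum.Crystallization.Theorems.OverbindingBudgetAffineFarSmoothSplit

open Literature.MathematicalPhysics.StatisticalMechanics
open Literature.Geometry.DiscreteGeometry

/-! ## §1  Inward contact neighbours -/

/-- **Inward contact neighbour**: a non-zero site `u` of `𝓛(t)` (`t` Hägg) touches a site of strictly smaller norm — `0` if `‖u‖ = 1`,
else `u + e` with `e` from C1's covering-constant lemma `exists_barlowShell_norm_map_add_lt` at `B = id`. [this file] -/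
theorem exists_inward_neighbour {t : ℤ → ℤ} (ht : IsHaggSeq t) {u : EuclideanSpace ℝ (Fin 3)}
    (hu : u ∈ barlowStacking 1 (Real.sqrt (2 / 3)) t) (hu0 : u ≠ 0) :
    ∃ u' ∈ barlowStacking 1 (Real.sqrt (2 / 3)) t, ‖u'‖ < ‖u‖ ∧ dist u u' = 1 := by
  rcases norm_eq_one_or_sqrt_two_le ht hu hu0 with h1 | h2
  · refine ⟨0, zero_mem_barlowStacking t, ?_, ?_⟩
    · rw [norm_zero, h1]; exact one_pos
    · rw [dist_zero_right, h1]
  · have hsq : 2 ≤ ‖u‖ ^ 2 := by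
      have h0 : (0 : ℝ) ≤ Real.sqrt 2 := Real.sqrt_nonneg _
      have := Real.sq_sqrt (show (0 : ℝ) ≤ 2 by norm_num)
      nlinarith [h2, h0]
    obtain ⟨k, i, j, hq⟩ := hu
    have hσ := cast_letter_eq ht k
    have hτ := neg_cast_letter_eq ht (k - 1)
    obtain ⟨e, he, hlt⟩ := exists_barlowShell_norm_map_add_lt hσ hτ (LinearMap.id : EuclideanSpace ℝ (Fin 3) →ₗ[ℝ] EuclideanSpace ℝ (Fin 3))
      (fun v => by rw [LinearMap.id_apply]; linarith [norm_nonneg v])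
      (fun v => by rw [LinearMap.id_apply]; linarith [norm_nonneg v]) hsq
    rw [LinearMap.id_apply, LinearMap.id_apply] at hlt
    refine ⟨u + e, ?_, hlt, ?_⟩
    · rw [hq]; exact barlowPos_add_mem_of_mem_barlowShell ht k i j he
    · rw [dist_eq_norm, sub_add_cancel_left, norm_neg, norm_eq_one_of_mem_barlowShell hσ hτ he]

/-! ## §2  ★ Lattice filling (PROVED) -/

/-- **LATTICE FILLING, recentred form (PROVED)**: with `t` Hägg, `0 ∈ Λ`, exact two-shell patterns inside `Λ` at its points of norm `≤ ρ`,
and `Λ ∩ B̄(0, r) ⊆ g(𝓛(t))` (`r ≤ ρ + 1`): every `u ∈ 𝓛(t)` with `‖u‖ ≤ r − 1` has `g u ∈ Λ`.  Minimal counterexample + inward contact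
neighbour + contact-shell counting. [this file] -/
theorem barlow_fill_centred {Λ : Set (EuclideanSpace ℝ (Fin 3))} {ρ r : ℝ}
    (hshell : ∀ x ∈ Λ, ‖x‖ ≤ ρ →
      ∃ (A : EuclideanSpace ℝ (Fin 3) →ₗᵢ[ℝ] EuclideanSpace ℝ (Fin 3)) (P : Finset (EuclideanSpace ℝ (Fin 3))),
        (P = fccTwoShellPattern ∨ P = hcpTwoShellPattern) ∧ ∀ v ∈ P, x + A v ∈ Λ)
    {t : ℤ → ℤ} (ht : IsHaggSeq t) (g : EuclideanSpace ℝ (Fin 3) ≃ₗᵢ[ℝ] EuclideanSpace ℝ (Fin 3))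
    (hincl : ∀ x ∈ Λ, ‖x‖ ≤ r → ∃ u ∈ barlowStacking 1 (Real.sqrt (2 / 3)) t, x = g u)
    (hrρ : r ≤ ρ + 1) (h0 : (0 : EuclideanSpace ℝ (Fin 3)) ∈ Λ) :
    ∀ u ∈ barlowStacking 1 (Real.sqrt (2 / 3)) t, ‖u‖ ≤ r - 1 → g u ∈ Λ := by
  intro u hu hur
  by_contra hnot
  -- the finite set of bad sites and a norm-minimal one
  set S : Set (EuclideanSpace ℝ (Fin 3)) :=
    {v | v ∈ barlowStacking 1 (Real.sqrt (2 / 3)) t ∧ ‖v‖ ≤ r - 1 ∧ g v ∉ Λ} with hS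
  have hfin : S.Finite := by
    refine (finite_window t (r - 1)).subset ?_
    rintro v ⟨hv, hvr, -⟩
    exact ⟨hv, by rwa [dist_zero_right]⟩
  obtain ⟨u₀, ⟨hu₀, hu₀r, hbad⟩, hmin⟩ := Set.exists_min_image S (fun v => ‖v‖) hfin ⟨u, hu, hur, hnot⟩
  apply hbad
  have hu₀0 : u₀ ≠ 0 := by
    rintro rfl
    exact hbad (by rwa [map_zero])
  -- the inward contact neighbour `u₁` is good by minimality
  obtain ⟨u₁, hu₁, hlt, hd⟩ := exists_inward_neighbour ht hu₀ hu₀0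
  have hu₁r : ‖u₁‖ ≤ r - 1 := by linarith
  have hgood : g u₁ ∈ Λ := by
    by_contra h1
    exact absurd (hmin u₁ ⟨hu₁, hu₁r, h1⟩) (not_le.2 hlt)
  -- the pattern at `x = g u₁`
  obtain ⟨A, P, hP, hmem⟩ := hshell (g u₁) hgood (by rw [LinearIsometryEquiv.norm_map]; linarith)
  obtain ⟨k₁, i₁, j₁, hu₁eq⟩ := id hu₁
  have hσ := cast_letter_eq ht k₁
  have hτ := neg_cast_letter_eq ht (k₁ - 1)
  obtain ⟨hKcard, -⟩ := ncard_kissing_eq_twelve hP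
  -- `v ↦ g⁻¹(A v)` maps the twelve kissing vectors injectively into the contact shell of `u₁`
  have hmaps : ∀ v (hv : v ∈ {v : EuclideanSpace ℝ (Fin 3) | v ∈ P ∧ ‖v‖ = 1}),
      (fun (v : EuclideanSpace ℝ (Fin 3)) (_ : v ∈ {v : EuclideanSpace ℝ (Fin 3) | v ∈ P ∧ ‖v‖ = 1}) => g.symm (A v)) v hv ∈
        barlowShell (t k₁ : ℝ) (-((t (k₁ - 1) : ℤ) : ℝ)) := by
    rintro v ⟨hvP, hv1⟩
    show g.symm (A v) ∈ _
    have hn : ‖g u₁ + A v‖ ≤ r := by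
      calc ‖g u₁ + A v‖ ≤ ‖g u₁‖ + ‖A v‖ := norm_add_le _ _
        _ = ‖u₁‖ + 1 := by rw [LinearIsometryEquiv.norm_map, A.norm_map, hv1]
        _ ≤ r := by linarith
    obtain ⟨w, hw, hweq⟩ := hincl _ (hmem v hvP) hn
    have hq : u₁ + g.symm (A v) = w := by
      apply g.injective
      rw [map_add, LinearIsometryEquiv.apply_symm_apply, hweq]
    have hwmem : u₁ + g.symm (A v) ∈ barlowStacking 1 (Real.sqrt (2 / 3)) t := by rw [hq]; exact hw
    have hd1 : dist (u₁ + g.symm (A v)) (barlowPos 1 (Real.sqrt (2 / 3)) t k₁ i₁ j₁) = 1 := by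
      rw [← hu₁eq, dist_eq_norm, add_sub_cancel_left, LinearIsometryEquiv.norm_map, A.norm_map, hv1]
    have h := sub_mem_barlowShell_of_dist_eq_one ht k₁ i₁ j₁ hwmem hd1
    rwa [← hu₁eq, add_sub_cancel_left] at h
  have hinj : ∀ v w (hv : v ∈ {v : EuclideanSpace ℝ (Fin 3) | v ∈ P ∧ ‖v‖ = 1}) (hw : w ∈ {v : EuclideanSpace ℝ (Fin 3) | v ∈ P ∧ ‖v‖ = 1}),
      (fun (v : EuclideanSpace ℝ (Fin 3)) (_ : v ∈ {v : EuclideanSpace ℝ (Fin 3) | v ∈ P ∧ ‖v‖ = 1}) => g.symm (A v)) v hv =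
        (fun (v : EuclideanSpace ℝ (Fin 3)) (_ : v ∈ {v : EuclideanSpace ℝ (Fin 3) | v ∈ P ∧ ‖v‖ = 1}) => g.symm (A v)) w hw → v = w :=
    fun v w _ _ h => A.injective (g.symm.injective h)
  have hsurj := Set.surj_on_of_inj_on_of_ncard_le
    (fun (v : EuclideanSpace ℝ (Fin 3)) (_ : v ∈ {v : EuclideanSpace ℝ (Fin 3) | v ∈ P ∧ ‖v‖ = 1}) => g.symm (A v)) hmaps hinj
    (by rw [hKcard, ncard_barlowShell hσ hτ]) (finite_barlowShell _ _)
  -- `u₀ − u₁` is a contact vector at `u₁`, hence hit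
  have hmemS : u₀ - u₁ ∈ barlowShell (t k₁ : ℝ) (-((t (k₁ - 1) : ℤ) : ℝ)) := by
    have h := sub_mem_barlowShell_of_dist_eq_one ht k₁ i₁ j₁ hu₀ (by rw [← hu₁eq]; exact hd)
    rwa [← hu₁eq] at h
  obtain ⟨v, ⟨hvP, -⟩, hv⟩ := hsurj (u₀ - u₁) hmemS
  have hv' : u₀ - u₁ = g.symm (A v) := hv
  have key : g u₀ = g u₁ + A v := by
    have h1 : A v = g (u₀ - u₁) := by
      rw [hv', LinearIsometryEquiv.apply_symm_apply]
    rw [h1, ← map_add, add_sub_cancel]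
  rw [key]
  exact hmem v hvP

/-- **★ LATTICE FILLING, based form (PROVED)**: with `s` Hägg, `p₀ ∈ 𝓛(s)`, `0 ∈ Λ`, exact two-shell patterns inside `Λ` at its points of
norm `≤ ρ`, and `Λ ∩ B̄(0, r) ⊆ g(𝓛(s) − p₀)` (`r ≤ ρ + 1`): every `p ∈ 𝓛(s)` with `‖p − p₀‖ ≤ r − 1` has `g(p − p₀) ∈ Λ`. [this file] -/
theorem barlow_fill {Λ : Set (EuclideanSpace ℝ (Fin 3))} {ρ r : ℝ}
    (hshell : ∀ x ∈ Λ, ‖x‖ ≤ ρ →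
      ∃ (A : EuclideanSpace ℝ (Fin 3) →ₗᵢ[ℝ] EuclideanSpace ℝ (Fin 3)) (P : Finset (EuclideanSpace ℝ (Fin 3))),
        (P = fccTwoShellPattern ∨ P = hcpTwoShellPattern) ∧ ∀ v ∈ P, x + A v ∈ Λ)
    {s : ℤ → ℤ} (hs : IsHaggSeq s) (g : EuclideanSpace ℝ (Fin 3) ≃ₗᵢ[ℝ] EuclideanSpace ℝ (Fin 3))
    {p₀ : EuclideanSpace ℝ (Fin 3)} (hp₀ : p₀ ∈ barlowStacking 1 (Real.sqrt (2 / 3)) s)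
    (hincl : ∀ x ∈ Λ, ‖x‖ ≤ r → ∃ p ∈ barlowStacking 1 (Real.sqrt (2 / 3)) s, x = g (p - p₀))
    (hrρ : r ≤ ρ + 1) (h0 : (0 : EuclideanSpace ℝ (Fin 3)) ∈ Λ) :
    ∀ p ∈ barlowStacking 1 (Real.sqrt (2 / 3)) s, ‖p - p₀‖ ≤ r - 1 → g (p - p₀) ∈ Λ := by
  obtain ⟨k₀, i₀, j₀, hp₀eq⟩ := id hp₀
  have ht : IsHaggSeq (fun n => s (n + k₀)) := fun n => hs (n + k₀)
  have hincl' : ∀ x ∈ Λ, ‖x‖ ≤ r → ∃ u ∈ barlowStacking 1 (Real.sqrt (2 / 3)) (fun n => s (n + k₀)), x = g u := by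
    intro x hx hxr
    obtain ⟨p, hp, rfl⟩ := hincl x hx hxr
    exact ⟨p - p₀, (mem_shift_iff hp₀eq (p - p₀)).2 (by rwa [sub_add_cancel]), rfl⟩
  intro p hp hpr
  exact barlow_fill_centred hshell ht g hincl' hrρ h0 (p - p₀) ((mem_shift_iff hp₀eq (p - p₀)).2 (by rwa [sub_add_cancel])) hpr

end Summit.AtomisticToContinuum.Crystallization.Theorems.OverbindingBudgetAffineFarSmoothSplit
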